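import Mathlib
import HarnessLib
import Summits.RiemannHypothesis.RiemannHypothesis.Theses.OneSidedGoldbach
import Literature.NumberTheory.Sieve.GranvilleGoldbachProofs

/-!
# Line `birth` — BC3 skeleton for the crux `GoldbachUpperFace` (stmt-RiemannHypothesis-1121)

Route `OneSidedGoldbach` (route-RiemannHypothesis-OneSidedGoldbach), crux (rank 2, RH-equivalent)
`GoldbachUpperFace`: for every `ε > 0` there is `C` with
`S_Λ(n) − n²/2 ≤ C (n+1)^{3/2+ε}` for all `n : ℕ`, where
`S_Λ(n) = ∑_{m ≤ n} ∑_{i+j=m} Λ(i)Λ(j)` (`Literature.NumberTheory.LFunctions.selfConvSum`).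

## THE LINE = LINEAR / BILINEAR SPLIT OF THE GOLDBACH AVERAGE

Write `Λ = 1 + b`, `b(k) = Λ(k) − 1` (Bhowmik–Schlage-Puchta's `S = T + R`, Languasco–Zaccagnini's
decomposition of `∑_{n ≤ N} R(n)`). Expanding the convolution square on each antidiagonal and using the
swap symmetry `∑_{i+j=m} b(j) = ∑_{i+j=m} b(i)` gives the EXACT finite identity
(`selfConvSum_vonMangoldt_expand`, sorry-free below)

  `S_Λ(n) = S_1(n) + 2·L(n) + Q(n)`,   `S_1(n) = (n+1)(n+2)/2` (tree: `selfConvSum_one`),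

with the LINEAR (prime-counting, Cesàro-smoothed) statistic

  `L(n) := ∑_{a ≤ n} (Λ(a) − 1)(n − a + 1) = ∑_{m ≤ n} (ψ(m) − m − 1) = ψ₁(n+1) − (n+1)(n+2)/2`

(`ψ₁(N) = ∑_{a ≤ N} Λ(a)(N − a) = ∫₀^N ψ`) and the BILINEAR statistic

  `Q(n) := ∑_{m ≤ n} ∑_{i+j=m} (Λ(i) − 1)(Λ(j) − 1) = selfConvSum (Λ − 1) n`.

Since both enter with a `+` sign, ONE-SIDED upper bounds add:
`S_Λ(n) − n²/2 = (3n+2)/2 + 2L(n) + Q(n) ≤ (2A₁ + A₂ + 2)(n+1)^{3/2+ε}` from `L(n) ≤ A₁(n+1)^{3/2+ε}`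
(stub 1) and `Q(n) ≤ A₂(n+1)^{3/2+ε}` (stub 2) — `upperFace_of_faces`, sorry-free; `GoldbachUpperFace_of`
is the crux BY NAME from the two declared stubs.

Where the difficulty lives (honest): the crux is RH-equivalent, so the conjunction of the stubs is
RH-strength; the split puts ALL of the `x^{3/2}` oscillation into the linear face and leaves a bilinear
face of strictly lower (quasi-RH(3/4)) strength:
* stub 1 (`stub_psiOneFace`, the one-sided Cesàro–von Koch bound) is RH-EQUIVALENT: RH ⇒ it even at
  `ε = 0` (`ψ₁(x) − x²/2 = −∑_ρ x^{ρ+1}/(ρ(ρ+1)) − x log 2π + O(1)`, `∑_ρ |ρ|^{-2} < ∞`;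
  MontgomeryVaughan2007 §12.1/§13.1, Ex. 15.1.2); it ⇒ the route's hub `LaplaceUpperHub` by an Abelian step
  that is LINEAR in `δ(t) = F(t) − 1/t` (generating function `∑ L(n) zⁿ = B(z)/(1−z)²`,
  `B = F − 1/(1−z)`, `z = e^{−t}`; multiply by `(1−z)² > 0` — no square root, no sign to fix), hence ⇒ RH
  by `LandauStepUpper` (item 1125).
* stub 2 (`stub_bilinearFace`) is TWO-SIDED BY NATURE: by the tree identity `laplaceSeries_sq` with
  `a = Λ − 1`, `B(t)² = (1 − e^{−t}) ∑ Q(n) e^{−nt}`, so the one-sided bound `Q(n) ≤ A(n+1)^{3/2+ε}` already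
  gives `|F(t) − 1/t| ≪ t^{−3/4−ε/2}`, i.e. `ζ ≠ 0` on `Re s > 3/4` (tree template
  `quasiRiemannHypothesis_of_laplaceSeries_vonMangoldt_isBigO`) — open, so not cheap — while RH gives it
  with a full power to spare: `Q(N) = O(N log³N)` (LanguascoZaccagnini2012, the term `∫ T(−α)R(α)² dα`;
  BhowmikSchlagepuchta2010 §2: `O(N log⁵N)`, "no non-trivial unconditional version … without better
  understanding of the zeros"). Heuristically stub 2 ⟺ `Θ ≤ 3/4`.
So the line says: the upper Goldbach face IS the one-sided `ψ₁` face plus a bilinear remainder of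
quasi-RH(3/4) strength — the additive (pair) structure costs nothing beyond `Θ ≤ 3/4`; the RH content of
the crux is the smoothed linear prime-counting inequality, the natural target of one-sided (Fejér-type
positive kernel / majorant) technology.

## Contents

* `stub_psiOneFace`, `stub_bilinearFace` — the ONLY `sorry`s of the file (registered stubs).
* sorry-free infrastructure: `sum_antidiagonal_snd_eq_fst` (swap symmetry), `selfConv_vonMangoldt_expand`
  (the expansion on one antidiagonal), `selfConvSum_vonMangoldt_expand` (the finite identity
  `S_Λ = S_1 + 2L + Q`), `succ_le_succ_rpow`, `upperFace_of_faces` (stub signatures ⇒ the crux's body).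
* `GoldbachUpperFace_of : GoldbachUpperFace` — THE skeleton theorem: the crux BY NAME from the two
  declared stubs (the file's only theorem whose head is the crux decl, as `ledger skeleton check` requires).

Disproof.lean for this crux: none exists (`ledger crux ls stmt-RiemannHypothesis-1121`: no workfiles,
2026-08-17) — no `_false_without_` obligation to honour; negatives index (2026-08-17): one entry
(UniversalFactor.LaplaceLoophole), unrelated. Barrier `LittlewoodOscillation`: both stubs sit at the RH
scale with RH-supplied constants and are SMOOTHED (`ψ₁`, Cesàro) or two-sided-by-nature (`Q`); neither is
the sharp-cutoff `ψ(x) ≤ x + C√x` the barrier kills (MV Thm 15.11).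
-/

set_option linter.dupNamespace false
set_option linter.unusedVariables false

noncomputable section

namespace Summit.RiemannHypothesis.RiemannHypothesis.Cruxes.GoldbachUpperFace.Birth

open Finset
open scoped Chebyshev ArithmeticFunction.vonMangoldt
open Literature.NumberTheory.LFunctions
open Literature.NumberTheory.Sieve.GoldbachAverage
open Summit.RiemannHypothesis.RiemannHypothesis.Theses.OneSidedGoldbach

/-! ## The two registered stubs -/

/-- **Stub 1 — the one-sided `ψ₁` (Cesàro–von Koch) face.** For every `ε > 0` there is `A` with
`L(n) = ∑_{a ≤ n} (Λ(a) − 1)(n − a + 1) ≤ A (n+1)^{3/2+ε}` for all `n`; here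
`L(n) = ∑_{m ≤ n} (ψ(m) − m − 1) = ψ₁(n+1) − (n+1)(n+2)/2`, the Cesàro-smoothed prime-counting remainder.
Why plausibly true: it is implied by RH, even at `ε = 0` with any
`A > ∑_ρ |ρ(ρ+1)|^{-1}` for large `n` (explicit formula for `ψ₁`, absolutely convergent zero sum;
MontgomeryVaughan2007 §12.1, §13.1, Ex. 15.1.2 `ψ₁(x) − x²/2 = Ω±(x^{3/2})`). Strength: RH-EQUIVALENT —
it implies the route's `LaplaceUpperHub` by a LINEAR Abelian step (`∑ L(n) zⁿ = (F − 1/(1−z))/(1−z)²` at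
`z = e^{−t}`; tree: `tsum_pow_succ_rpow_mul_exp_le`, `one_sub_exp_neg_bounds`), hence RH via
`LandauStepUpper`; so it is exactly as hard as the crux, but it is a statement about primes ALONE
(linear, smoothed), the natural target of one-sided positive-kernel / majorant technology. Size: XL (open,
RH-equivalent). Sources: MontgomeryVaughan2007 (§13.1, §15.1), BhowmikSchlagepuchta2010 (§2: the term
`2∑_{n ≤ x−1}(Ψ(n) − n) = H(x) + O(x)`), LanguascoZaccagnini2012.
[cite: MontgomeryVaughan2007, §15.1 Ex. 15.1.2] -/
theorem stub_psiOneFace :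
    ∀ ε : ℝ, 0 < ε → ∃ A : ℝ, ∀ n : ℕ,
      ∑ a ∈ Finset.range (n + 1), ((Λ a : ℝ) - 1) * (((n - a : ℕ) : ℝ) + 1) ≤
        A * ((n : ℝ) + 1) ^ (3 / 2 + ε) := by
  sorry

/-- **Stub 2 — the bilinear face.** For every `ε > 0` there is `A` with
`Q(n) = selfConvSum (Λ − 1) n = ∑_{m ≤ n} ∑_{i+j=m} (Λ(i) − 1)(Λ(j) − 1) ≤ A (n+1)^{3/2+ε}` for all `n`.
Why plausibly true: under RH `Q(N) = O(N log³N)` — a full power below what is asked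
(LanguascoZaccagnini2012: the bilinear term `∫₀¹ T(−α)R(α)² dα` of `∑_{n ≤ N} R(n)`;
BhowmikSchlagepuchta2010 §2: `O(N log⁵N)` via the local mean square of `R = S − T`). Strength: strictly
BELOW RH but open — the tree identity `laplaceSeries_sq` with `a = Λ − 1` reads
`(F(t) − 1/(1−e^{−t}))² = (1 − e^{−t}) ∑ Q(n)e^{−nt}`, a SQUARE, so this ONE-sided bound already yields the
TWO-sided `|F(t) − 1/t| ≪ t^{−3/4−ε/2}` and hence `ζ(s) ≠ 0` for `Re s > 3/4`
(`quasiRiemannHypothesis_of_laplaceSeries_vonMangoldt_isBigO`); heuristically it is equivalent to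
`Θ ≤ 3/4`. Size: L–XL (quasi-RH(3/4) strength). Sources: LanguascoZaccagnini2012,
BhowmikSchlagepuchta2010, BhowmikRuzsa2018 (proof of Thm 2.1, the power-series step), tree
`Literature.NumberTheory.LFunctions.laplaceSeries_sq`.
[cite: LanguascoZaccagnini2012, Thm. 1 (the O(N log³ N) term)] -/
theorem stub_bilinearFace :
    ∀ ε : ℝ, 0 < ε → ∃ A : ℝ, ∀ n : ℕ,
      selfConvSum (fun k ↦ (Λ k : ℝ) - 1) n ≤ A * ((n : ℝ) + 1) ^ (3 / 2 + ε) := by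
  sorry

/-! ## Sorry-free infrastructure: the finite identity `S_Λ = S_1 + 2L + Q` -/

/-- Swap symmetry on an antidiagonal: `∑_{i+j=m} b(j) = ∑_{i+j=m} b(i)` for `b = Λ − 1`. [folklore] -/
theorem sum_antidiagonal_snd_eq_fst (m : ℕ) :
    ∑ ij ∈ antidiagonal m, ((Λ ij.2 : ℝ) - 1) = ∑ ij ∈ antidiagonal m, ((Λ ij.1 : ℝ) - 1) :=
  Finset.Nat.sum_antidiagonal_swap (f := fun p : ℕ × ℕ ↦ (Λ p.1 : ℝ) - 1)

/-- The expansion on one antidiagonal: with `Λ = 1 + b`,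
`∑_{i+j=m} Λ(i)Λ(j) = ∑ 1 + 2∑ b(i) + ∑ b(i)b(j)`. [folklore] -/
theorem selfConv_vonMangoldt_expand (m : ℕ) :
    selfConv (fun k ↦ (Λ k : ℝ)) m =
      selfConv (fun _ ↦ (1 : ℝ)) m +
        2 * ∑ ij ∈ antidiagonal m, ((Λ ij.1 : ℝ) - 1) * 1 +
        selfConv (fun k ↦ (Λ k : ℝ) - 1) m := by
  have hpt : ∀ ij : ℕ × ℕ, (Λ ij.1 : ℝ) * (Λ ij.2 : ℝ) =
      (1 : ℝ) * 1 + (((Λ ij.1 : ℝ) - 1) + ((Λ ij.2 : ℝ) - 1)) +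
        ((Λ ij.1 : ℝ) - 1) * ((Λ ij.2 : ℝ) - 1) := by
    intro ij
    ring
  simp only [selfConv_def]
  rw [Finset.sum_congr rfl (fun ij _ ↦ hpt ij), Finset.sum_add_distrib, Finset.sum_add_distrib,
    Finset.sum_add_distrib, sum_antidiagonal_snd_eq_fst]
  simp only [mul_one]
  ring

/-- `∑_{m ≤ n} ∑_{i+j=m} b(i)·1 = ∑_{a ≤ n} b(a)(n − a + 1)` (collect by `a = i`). [folklore] -/
theorem sum_range_sum_antidiagonal_fst (n : ℕ) :
    ∑ m ∈ range (n + 1), ∑ ij ∈ antidiagonal m, ((Λ ij.1 : ℝ) - 1) * 1 =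
      ∑ a ∈ range (n + 1), ((Λ a : ℝ) - 1) * (((n - a : ℕ) : ℝ) + 1) := by
  rw [sum_range_sum_antidiagonal (fun k ↦ (Λ k : ℝ) - 1) (fun _ ↦ (1 : ℝ)) n]
  refine Finset.sum_congr rfl fun a _ ↦ ?_
  rw [Finset.sum_const, Finset.card_range, nsmul_eq_mul, mul_one]
  push_cast
  ring

/-- **The finite identity** `S_Λ(n) = S_1(n) + 2L(n) + Q(n)`. [folklore] -/
theorem selfConvSum_vonMangoldt_expand (n : ℕ) :
    selfConvSum (fun k ↦ (Λ k : ℝ)) n =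
      selfConvSum (fun _ ↦ (1 : ℝ)) n +
        2 * ∑ a ∈ range (n + 1), ((Λ a : ℝ) - 1) * (((n - a : ℕ) : ℝ) + 1) +
        selfConvSum (fun k ↦ (Λ k : ℝ) - 1) n := by
  rw [← sum_range_sum_antidiagonal_fst]
  simp only [selfConvSum_def]
  calc ∑ m ∈ range (n + 1), selfConv (fun k ↦ (Λ k : ℝ)) m
      = ∑ m ∈ range (n + 1), (selfConv (fun _ ↦ (1 : ℝ)) m +
          2 * ∑ ij ∈ antidiagonal m, ((Λ ij.1 : ℝ) - 1) * 1 +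
          selfConv (fun k ↦ (Λ k : ℝ) - 1) m) :=
        Finset.sum_congr rfl fun m _ ↦ selfConv_vonMangoldt_expand m
    _ = ∑ m ∈ range (n + 1), selfConv (fun _ ↦ (1 : ℝ)) m +
          2 * ∑ m ∈ range (n + 1), ∑ ij ∈ antidiagonal m, ((Λ ij.1 : ℝ) - 1) * 1 +
          ∑ m ∈ range (n + 1), selfConv (fun k ↦ (Λ k : ℝ) - 1) m := by
        rw [Finset.sum_add_distrib, Finset.sum_add_distrib, Finset.mul_sum]

/-- `n + 1 ≤ (n+1)^{3/2+ε}` for `ε > 0` (absorbs the `(3n+2)/2` excess of `S_1(n)` over `n²/2`).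
[folklore] -/
theorem succ_le_succ_rpow (n : ℕ) {ε : ℝ} (hε : 0 < ε) :
    (n : ℝ) + 1 ≤ ((n : ℝ) + 1) ^ (3 / 2 + ε) := by
  have h1n : (1 : ℝ) ≤ (n : ℝ) + 1 := by
    have := (Nat.cast_nonneg n : (0 : ℝ) ≤ n)
    linarith
  calc (n : ℝ) + 1 = ((n : ℝ) + 1) ^ (1 : ℝ) := (Real.rpow_one _).symm
    _ ≤ ((n : ℝ) + 1) ^ (3 / 2 + ε) := Real.rpow_le_rpow_of_exponent_le h1n (by linarith)

/-- **The composition** (sorry-free): the two stub SIGNATURES, taken as hypotheses, give the body of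
the crux — `S_Λ(n) − n²/2 = (3n+2)/2 + 2L(n) + Q(n) ≤ (2A₁ + A₂ + 2)(n+1)^{3/2+ε}`. [folklore] -/
theorem upperFace_of_faces
    (h₁ : ∀ ε : ℝ, 0 < ε → ∃ A : ℝ, ∀ n : ℕ,
      ∑ a ∈ Finset.range (n + 1), ((Λ a : ℝ) - 1) * (((n - a : ℕ) : ℝ) + 1) ≤
        A * ((n : ℝ) + 1) ^ (3 / 2 + ε))
    (h₂ : ∀ ε : ℝ, 0 < ε → ∃ A : ℝ, ∀ n : ℕ,
      selfConvSum (fun k ↦ (Λ k : ℝ) - 1) n ≤ A * ((n : ℝ) + 1) ^ (3 / 2 + ε)) :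
    ∀ ε : ℝ, 0 < ε → ∃ C : ℝ, ∀ n : ℕ,
      selfConvSum (fun k ↦ (ArithmeticFunction.vonMangoldt k : ℝ)) n - (n : ℝ) ^ 2 / 2 ≤
        C * ((n : ℝ) + 1) ^ (3 / 2 + ε) := by
  intro ε hε
  obtain ⟨A₁, hA₁⟩ := h₁ ε hε
  obtain ⟨A₂, hA₂⟩ := h₂ ε hε
  refine ⟨2 * A₁ + A₂ + 2, fun n ↦ ?_⟩
  have h1 := hA₁ n
  have h2 := hA₂ n
  have hX := succ_le_succ_rpow n hε
  rw [selfConvSum_vonMangoldt_expand, selfConvSum_one]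
  linarith [h1, h2, hX]

/-! ## The skeleton theorem: the crux BY NAME from the two declared stubs -/

/-- **THE SKELETON THEOREM.** The crux
`Summit.RiemannHypothesis.RiemannHypothesis.Theses.OneSidedGoldbach.GoldbachUpperFace`, concluded BY
NAME from the two DECLARED stubs `stub_psiOneFace`, `stub_bilinearFace` (the only `sorry`s of the file)
through the sorry-free composition `upperFace_of_faces`. [folklore] -/
theorem GoldbachUpperFace_of : GoldbachUpperFace :=
  upperFace_of_faces stub_psiOneFace stub_bilinearFace

end Summit.RiemannHypothesis.RiemannHypothesis.Cruxes.GoldbachUpperFace.Birth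

end
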